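import Mathlib
import HarnessLib
import Summits.NavierStokesRegularity.NavierStokesRegularity.Theorems.FrequencyGrowthExponent.Negative.Reductions
import Summits.NavierStokesRegularity.NavierStokesRegularity.Theorems.LoopPeriodRatchetNoPlanarExtremum

/-!
# Crux `FrequencyGrowthExponent` (stmt-NavierStokesRegularity-27893), negative side:
# what the wall gives the rest of the line — loop-freeness and planar-extremum-freeness become automatic

Negative-side (cdisprove, D-0016) bookkeeping for the wall `LoopPeriodRatchet.FrequencyGrowthExponent`; nothing here
closes or changes any item (`--supports`).  `closes` of route LoopPeriodRatchet consumes the wall ⟨27893⟩ together with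
`OpenLoopLiouville` (22493, split into the proved `NoPlanarExtremum` 22880 + the open `PlanarExtremumLiouville` 22881).
By `Negative/Reductions.not_frequencyGrowthExponent_iff` the wall says that NO class e₃-poloidal profile carries a
non-stationary closed vortex line; read positively (`loopFree_of_frequencyGrowthExponent`) this is exactly the
loop-free hypothesis of 22493, and through the proved 22880 (`noPlanarExtremum_of_frequencyGrowthExponent`) exactly the
no-strict-planar-extremum hypothesis of 22881.  Consequently (`openLoopLiouville_iff_planarExtremumLiouville_of_frequencyGrowthExponent`)
the two residual cruxes COINCIDE once the wall holds, and both then amount to the hypothesis-free statement «every nonflat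
Frobenius-class e₃-poloidal Type-I ancient mild profile is not backward-singular at the apex» (spelled out, with a name,
in the crux workfile `Cruxes/FrequencyGrowthExponent/Disproof.lean` §I).  Planner information for the negation-first
reading: the topological / maximum-principle hypotheses of the residual cruxes carry no information beyond the wall.
HONEST FRAMING: pure logic over landed theorems; item 27893, 22493, 22881 stay OPEN; nothing here bears on
`PoloidalWindowDoor.Target` or on Navier–Stokes regularity.
-/

noncomputable section

-- the summit and its single sub-problem share the name (CONVENTIONS §1), as in every Theorems file
set_option linter.dupNamespace false

namespace Summit.NavierStokesRegularity.NavierStokesRegularity.Theorems.FrequencyGrowthExponent.Negative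

open Set Function Filter Topology
open scoped RealInnerProductSpace InnerProductSpace
open Literature.Analysis Literature.Analysis.FluidPDE Literature.Analysis.UnboundedOperators
open Summit.NavierStokesRegularity.NavierStokesRegularity.Theses.LoopPeriodRatchet
open Summit.NavierStokesRegularity.NavierStokesRegularity.Theorems

variable {C : ℝ} {v : ℝ → EuclideanSpace ℝ (Fin 3) → EuclideanSpace ℝ (Fin 3)}

/-- **The wall makes every class e₃-poloidal profile loop-free** (in the currency of 22493 / 22880: every periodic
integral curve of `curl v(s,·)`, `s < 0`, is stationary). -/
theorem loopFree_of_frequencyGrowthExponent (hG : FrequencyGrowthExponent) (hrate : HasTypeITimeDecay C v)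
    (hcont : ContinuousOn (uncurry v) (Iio (0 : ℝ) ×ˢ univ))
    (hmild : ∀ s t : ℝ, s < t → t < 0 → ∀ x, v t x = heatExtension (v s) (t - s) x - oseenDuhamel 1 s v v t x)
    (hdiv : ∀ t < 0, VectorCalculus.IsDivFree (v t))
    (hpol : ∀ s < 0, ∀ y, ⟪curl (v s) y, EuclideanSpace.single 2 1⟫_ℝ = 0) :
    ∀ s : ℝ, s < 0 → ∀ (γ : ℝ → EuclideanSpace ℝ (Fin 3)) (ℓ : ℝ), 0 < ℓ →
      (∀ θ, HasDerivAt γ (curl (v s) (γ θ)) θ) → (∀ θ, γ (θ + ℓ) = γ θ) → curl (v s) (γ 0) = 0 := by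
  intro s hs γ ℓ hℓ hγ hper
  by_contra hne
  exact frequencyGrowthExponent_false_of_hasClassLoop
    ⟨C, v, hrate, hcont, hmild, hdiv, hpol, s, hs, γ, ℓ, hℓ, hper, hγ, 0, hne⟩ hG

/-- **The wall makes every class e₃-poloidal profile planar-extremum-free** (the hypothesis of 22881), through the
proved `NoPlanarExtremum` (22880). -/
theorem noPlanarExtremum_of_frequencyGrowthExponent (hG : FrequencyGrowthExponent) (hrate : HasTypeITimeDecay C v)
    (hcont : ContinuousOn (uncurry v) (Iio (0 : ℝ) ×ˢ univ))
    (hmild : ∀ s t : ℝ, s < t → t < 0 → ∀ x, v t x = heatExtension (v s) (t - s) x - oseenDuhamel 1 s v v t x)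
    (hdiv : ∀ t < 0, VectorCalculus.IsDivFree (v t))
    (hpol : ∀ s < 0, ∀ y, ⟪curl (v s) y, EuclideanSpace.single 2 1⟫_ℝ = 0) :
    ∀ s : ℝ, s < 0 → ∀ Φ : EuclideanSpace ℝ (Fin 3) → ℝ, ContDiff ℝ 2 Φ →
      (∀ y, v s y 0 = fderiv ℝ Φ y (EuclideanSpace.single 0 1) ∧ v s y 1 = fderiv ℝ Φ y (EuclideanSpace.single 1 1)) →
      ∀ y₀ : EuclideanSpace ℝ (Fin 3),
        (¬ ∀ᶠ y in nhdsWithin y₀ {y | y 2 = y₀ 2 ∧ y ≠ y₀},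
            v s y₀ 2 - fderiv ℝ Φ y₀ (EuclideanSpace.single 2 1) < v s y 2 - fderiv ℝ Φ y (EuclideanSpace.single 2 1)) ∧
        (¬ ∀ᶠ y in nhdsWithin y₀ {y | y 2 = y₀ 2 ∧ y ≠ y₀},
            v s y 2 - fderiv ℝ Φ y (EuclideanSpace.single 2 1) < v s y₀ 2 - fderiv ℝ Φ y₀ (EuclideanSpace.single 2 1)) :=
  LoopPeriodRatchetNoPlanarExtremum.noPlanarExtremum_proof C v hrate hcont hmild hdiv hpol
    (loopFree_of_frequencyGrowthExponent hG hrate hcont hmild hdiv hpol)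

/-- **Given the wall, the two residual cruxes of the line coincide**: `FrequencyGrowthExponent →
(OpenLoopLiouville ↔ PlanarExtremumLiouville)` — each is then the hypothesis-free Frobenius-class statement, because
the hypothesis distinguishing them is supplied by the wall. -/
theorem openLoopLiouville_iff_planarExtremumLiouville_of_frequencyGrowthExponent (hG : FrequencyGrowthExponent) :
    OpenLoopLiouville ↔ PlanarExtremumLiouville := by
  constructor
  · intro hO C v hrate hcont hmild hdiv hpol hfro hnf _
    exact hO C v hrate hcont hmild hdiv hpol hfro hnf (loopFree_of_frequencyGrowthExponent hG hrate hcont hmild hdiv hpol)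
  · intro hP C v hrate hcont hmild hdiv hpol hfro hnf _
    exact hP C v hrate hcont hmild hdiv hpol hfro hnf
      (noPlanarExtremum_of_frequencyGrowthExponent hG hrate hcont hmild hdiv hpol)

end Summit.NavierStokesRegularity.NavierStokesRegularity.Theorems.FrequencyGrowthExponent.Negative

end
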